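import Summits.MatrixMultiplication.OmegaCensus.STPPSmallPatternKernelSearch122B

/-!
# ω-census, small STPP pattern `(1,2,2)^k`: second-level chunking — PER-START chunk lists

HONEST FRAMING (pub-omega census; verbatim): lottery ticket; floor = certified bounds/negative ranges.
Census STRUCTURE bookkeeping of the STPP track (seat pub-omega-stpp-3, gen 24; STRUCTURE row B5, column `T2`), not progress on `ω`.

`not_exists_isSTPP_122_of_search2xx_dualP` (`STPPSmallPatternKernelSearch122B.lean`) takes ONE second-level chunk list; a cell with
many second-level chunks (`ℤ/30`: 156) cannot even state that list in one declaration within the elaborator's budget.  Here the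
starts certified at the second level form a list `XX` of pairs `(y, c'₀)`, and for each of them the cell supplies ITS OWN chunk list
with its own kernel search and `b₁`-cover (`not_exists_isSTPP_122_of_search2xx_dualY`); the first-level cover only tests membership
in `XX`.

References: H. Cohn, R. Kleinberg, B. Szegedy, C. Umans, FOCS 2005 (arXiv:math/0511460), Def. 5.1.
-/

namespace Summit.MatrixMultiplication.OmegaCensus

namespace STPP122Neg

open STPP211Neg Literature.Computability.AlgebraicComplexity

section Refl

variable {G : Type} [AddCommGroup G] {K : ℕ}

/-- **REFLECTION THROUGH DEF. 5.1 with first-level chunks and PER-START second-level chunk lists** (parametrised maps, stabiliser +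
duality cover). [cite: CohnKleinbergSzegedyUmans2005, Def. 5.1] -/
theorem not_exists_isSTPP_122_of_search2xx_dualY [DecidableEq G] (E : GEnc G) (hK : 2 ≤ K) {chunks : List (ℕ × ℕ)}
    (hsearch : search2x E.g K chunks = true) (XX : List (ℕ × ℕ))
    (hxx : ∀ p ∈ XX, ∃ ch3 : List (ℕ × ℕ × ℕ), search2xx E.g K ch3 = true ∧
      ∀ v, v < E.g.n → ∃ e ∈ ch3, e.1 = p.1 ∧ e.2.1 = p.2 ∧ e.2.2.testBit v = false)
    {reps : List ℕ} {ι κ : Type*} (mkA : ι → G → G) (IA : List ι)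
    (haddA : ∀ i ∈ IA, ∀ a b : G, mkA i (a + b) = mkA i a + mkA i b) (hkerA : ∀ i ∈ IA, ∀ x : G, mkA i x = 0 → x = 0)
    (hcover : ∀ d : G, d ≠ 0 → ∃ i ∈ IA, E.enc (mkA i d) ∈ reps)
    (mkS : κ → G → G) (IS : List κ)
    (haddS : ∀ j ∈ IS, ∀ a b : G, mkS j (a + b) = mkS j a + mkS j b) (hkerS : ∀ j ∈ IS, ∀ x : G, mkS j x = 0 → x = 0)
    (hchunks : ∀ d : G, E.enc d ∈ reps → ∀ z : G,
      (∃ j ∈ IS, mkS j d = d ∧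
        ((∃ e ∈ chunks, e.1 = E.enc d ∧ e.2.testBit (E.enc (mkS j z)) = false) ∨
         (E.enc d, E.enc (mkS j z)) ∈ XX)) ∨
      (∃ i ∈ IA, E.enc (mkA i (-z)) ∈ reps ∧ ∃ j ∈ IS, mkS j (mkA i (-z)) = mkA i (-z) ∧
        ((∃ e ∈ chunks, e.1 = E.enc (mkA i (-z)) ∧ e.2.testBit (E.enc (mkS j (mkA i (-d)))) = false) ∨
         (E.enc (mkA i (-z)), E.enc (mkS j (mkA i (-d)))) ∈ XX))) :
    ¬ ∃ A B C : Fin K → Finset G, IsSTPP A B C ∧ ∀ i, (A i).card = 1 ∧ (B i).card = 2 ∧ (C i).card = 2 := by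
  have hK1 : 0 < K := by omega
  rw [exists_isSTPP_122_iff]
  rintro ⟨p, p', q, q', hb, hc, hU, hX⟩
  have hM : ModelD2 p p' q q' := modelD2_of_finsetForm hb hc hU hX
  have haddLA : ∀ f ∈ IA.map mkA, ∀ a b : G, f (a + b) = f a + f b := fun f hf => by
    obtain ⟨i, hi, rfl⟩ := List.mem_map.1 hf; exact haddA i hi
  have haddLS : ∀ f ∈ IS.map mkS, ∀ a b : G, f (a + b) = f a + f b := fun f hf => by
    obtain ⟨j, hj, rfl⟩ := List.mem_map.1 hf; exact haddS j hj
  set LA : List (G →+ G) := (IA.map mkA).attach.map fun x => AddMonoidHom.mk' x.1 (haddLA x.1 x.2)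
  set LS : List (G →+ G) := (IS.map mkS).attach.map fun x => AddMonoidHom.mk' x.1 (haddLS x.1 x.2)
  have memLA : ∀ i ∈ IA, ∃ φ ∈ LA, ⇑φ = mkA i := fun i hi =>
    exists_mem_attach_map haddLA (List.mem_map.2 ⟨i, hi, rfl⟩)
  have memLS : ∀ j ∈ IS, ∃ φ ∈ LS, ⇑φ = mkS j := fun j hj =>
    exists_mem_attach_map haddLS (List.mem_map.2 ⟨j, hj, rfl⟩)
  have hinjA : ∀ φ ∈ LA, Function.Injective φ := fun φ hφ => by
    obtain ⟨f, hf, hφf⟩ := coe_mem_of_mem_attach_map hφ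
    obtain ⟨i, hi, rfl⟩ := List.mem_map.1 hf
    rw [hφf]; exact injective_of_additive_of_ker (haddA i hi) (hkerA i hi)
  have hinjS : ∀ φ ∈ LS, Function.Injective φ := fun φ hφ => by
    obtain ⟨f, hf, hφf⟩ := coe_mem_of_mem_attach_map hφ
    obtain ⟨j, hj, rfl⟩ := List.mem_map.1 hf
    rw [hφf]; exact injective_of_additive_of_ker (haddS j hj) (hkerS j hj)
  have hcoverA : ∀ d : G, d ≠ 0 → ∃ φ ∈ LA, E.enc (φ d) ∈ reps := fun d hd => by
    obtain ⟨i, hi, h⟩ := hcover d hd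
    obtain ⟨φ, hφ, hφf⟩ := memLA i hi
    exact ⟨φ, hφ, by rw [hφf]; exact h⟩
  -- the `good` predicate: first-level chunk or full second-level cover
  obtain ⟨r, r', s, s', hMr, hNF, hr0, hs0, -, hgood⟩ := exists_normalForm2_dual E hM hK1 hinjA hcoverA hinjS
    (good := fun y w => (∃ e ∈ chunks, e.1 = y ∧ e.2.testBit w = false) ∨ (y, w) ∈ XX) (fun d hd z => by
      rcases hchunks d hd z with ⟨j, hj, hjd, hrest⟩ | ⟨i, hi, hid, j, hj, hjd, hrest⟩
      · obtain ⟨ψ, hψ, hψg⟩ := memLS j hj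
        exact Or.inl ⟨ψ, hψ, by rw [hψg]; exact hjd, by rw [hψg]; exact hrest⟩
      · obtain ⟨φ, hφ, hφf⟩ := memLA i hi
        obtain ⟨ψ, hψ, hψg⟩ := memLS j hj
        refine Or.inr ⟨φ, hφ, by rw [hφf]; exact hid, ψ, hψ, by rw [hψg, hφf]; exact hjd, ?_⟩
        rw [hψg, hφf]; exact hrest)
  rcases hgood with ⟨e, he, h1, h2⟩ | hall
  · have := start2x_of_search2x hsearch e he
    obtain ⟨y, x1⟩ := e
    simp only at h1 h2
    subst h1
    rw [start2x_false hMr hNF hK1 hr0 hs0 h2] at this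
    exact Bool.false_ne_true this
  · obtain ⟨ch3, hsearch3, hcov⟩ := hxx _ hall
    obtain ⟨e, he, h1, h2, h3⟩ := hcov (E.enc (r ⟨1, hK⟩)) (E.enc_lt _)
    have := start2xx_of_search2xx hsearch3 e he
    obtain ⟨y, z, xb⟩ := e
    simp only at h1 h2 h3
    subst h1; subst h2
    rw [start2xx_false hMr hNF hK hr0 hs0 h3] at this
    exact Bool.false_ne_true this

end Refl

end STPP122Neg

end Summit.MatrixMultiplication.OmegaCensus
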